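import Summits.AtomisticToContinuum.HydrodynamicLimit.Theorems.TwoClocksEquilibriumFastWindowLDBirthT12ZonalComm
import HarnessLib

/-!
# The dipole (`ℓ = 1`) projection commutes with the linearised hard-sphere operator
# (helpers `t12_hardSphereLinearizedOp_dipolePart_comm` (Z2), `t12_hardSphereLinearizedOp_dipole`
# (Z2') of the line `birth`, crux `TwoClocks.EquilibriumFastWindowLD`,
# stmt-AtomisticToContinuum-14440; infrastructure file 4 of the analytic residue
# `t12_logLinearPreimage_and_dipoleModulus`)

The corrector analysis behind the registered sub-goal `t12_logLinearPreimage_and_dipoleModulus`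
splits `L ψ = g` (`L = hardSphereLinearizedOp` on `ℝ³`) into the angular sectors `ℓ = 0`,
`ℓ = 1`, `ℓ ≥ 2`; the decoupling rests on the commutation of the sector projections with `L`.
`…T12ZonalComm` did the zonal (`ℓ = 0`) average `Π₀`. This file does the **dipole (`ℓ = 1`)
projection** `Π₁ψ(v) := ⟪Φ_ψ(|v|), v⟫` (`dipolePart ψ v`), where
`Φ_ψ(r) = (3/(4πr)) ∫_{S²} ψ(rω) ω dσ(ω)` is the dipole profile of `…T12Zonal` (`dipoleProfile`,
literally the expression in the last clause of the sub-goal):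

* **Z2** (`hardSphereLinearizedOp_dipolePart`; registered form
  `t12_hardSphereLinearizedOp_dipolePart_comm` with `dipolePart` unfolded): for `ψ` measurable of
  Gaussian growth `|ψ(x)| ≤ C e^{|x|²/4}` and **every** `v`, `L(Π₁ψ)(v) = Π₁(Lψ)(v)`.
* **Z2'** (`t12_hardSphereLinearizedOp_dipole`): `L` maps dipole fields `⟪Φ(|·|), ·⟫` of that
  class to dipole fields, with output profile `Φ_{Lψ}`: `(Lψ)(v) = ⟪Φ_{Lψ}(|v|), v⟫`.

Route (character-weighted `O(3)` average; no spherical harmonics). With the Haar probability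
`dR` on `O(3) = unitary (E3 →L[ℝ] E3)` and `haarRot R = R⁻¹` of `…T12ZonalComm`, the key identity
is the **orbit form** `Π₁ψ(v) = 3 ∫_{O(3)} χ(R) ψ(R⁻¹v) dR` (`dipolePart_eq_integral_haar`), where
`χ(R) = tr R⁻¹ = tr R` (`rotTrace R`) is the character of the vector representation — a
superposition of rotates of `ψ` with `v`-INDEPENDENT weights, so that `Π₁` commutes with every
isotropic operator by Fubini, exactly as `Π₀ = ∫ (ψ ∘ R⁻¹) dR` in Z1. It is proved in two
elementary steps: (1) the matrix-coefficient form `Π₁ψ(v) = (3/|v|²) ∫ ⟪R⁻¹v, v⟫ ψ(R⁻¹v) dR`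
is the orbit identity `integral_haar_comp_eq_sphereAvg` (`∫ f(R⁻¹v) dR = (4π)⁻¹∫ f(|v|ω) dσ`)
for `f(u) = ⟪u, v⟫ ψ(u)`; (2) **the coefficient may be replaced by the character**:
`∫ (χ(R) - ⟪R⁻¹v, v⟫/|v|²) g(R⁻¹v) dR = 0` for every `g`
(`integral_haar_rotTrace_sub_coeff_mul_eq_zero`) — the reflection `S` in the line `ℝ v` fixes
`v` and is `-1` on `v^⊥`, the substitution `R ↦ SR` (left invariance of Haar) leaves `g(R⁻¹v)`
and `⟪R⁻¹v, v⟫` unchanged and turns `χ(R)` into `χ(SR) = 2⟪R⁻¹v, v⟫/|v|² - χ(R)`, so the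
integrand is odd under it (the one-element shadow of averaging over the stabiliser `O(2)`; no
integrability needed). Z2 is then Fubini in `dσ dM dR` (the rotated four-term kernel integrand
times `3χ(R)`, `|χ| ≤ 3`, is dominated by `36 C (1+|v|)e^{|v|²/4}(1+|v_*|)e^{|v_*|²/4}`,
`abs_kernelIntegrand_four_le`), isotropy `L(ψ ∘ R⁻¹)(v) = (Lψ)(R⁻¹v)`
(`hardSphereLinearizedOp_comp_linearIsometryEquiv_apply`, CIP 1994 §7.3 p. 209) and the orbit
form once more for `Lψ` (measurable, bounded on spheres: `…_of_gaussGrowth` lemmas of Z1).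

Also here: `dipolePart_dipole` (`Π₁` reproduces dipole fields at every `v`), the integral form
`dipolePart_eq_integral_sphere`, `|χ| ≤ 3`, continuity of `χ`. NOT here (sibling file
`…T12DipoleCommB`): the linear / sup-bound / measurability API of `Π₁`, `Π₁Π₀ = Π₀Π₁ = 0`,
idempotence, the `M`-orthogonality bookkeeping of `Π₁` against `span{1, v, |v|²}`, `ℓ ≥ 2`.
References: Cercignani–Illner–Pulvirenti 1994 §7.3 p. 209 (isotropy of `L`); Grad 1963 §4
(sectors); Folland, *A Course in Abstract Harmonic Analysis* §5.1–5.2 (matrix coefficients and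
characters of compact groups — the orbit form is Schur orthogonality for the vector
representation, proved here by hand).
-/
noncomputable section

open MeasureTheory ProbabilityTheory Real Set Filter Metric TopologicalSpace
open scoped ENNReal BigOperators InnerProductSpace

namespace Summit.AtomisticToContinuum.HydrodynamicLimit.Theorems.ClampedCorrectorBirth

open Literature.Analysis.FluidPDE Literature.MathematicalPhysics.KineticTheory
open Literature.Analysis.UnboundedOperators

attribute [local instance] continuousStar_clm compactSpace_unitary_clm isProbabilityMeasure_haarO3

/-! ### The dipole part `Π₁ψ(v) = ⟪Φ_ψ(|v|), v⟫` -/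

/-- **The dipole (`ℓ = 1`) part** `Π₁ψ(v) := ⟪Φ_ψ(|v|), v⟫` of a function `ψ` on `ℝ³`, where
`Φ_ψ(r) = (3/(4πr)) ∫_{S²} ψ(rω) ω dσ(ω)` is its dipole profile (`dipoleProfile ψ r`): the
`L²(S²)`-orthogonal projection, sphere by sphere, onto the linear functions `u ↦ ⟪a, u⟫`.
[folklore] -/
def dipolePart (ψ : EuclideanSpace ℝ (Fin 3) → ℝ) (v : EuclideanSpace ℝ (Fin 3)) : ℝ :=
  ⟪dipoleProfile ψ ‖v‖, v⟫_ℝ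

/-- **Dipole fields are reproduced**: `Π₁(⟪Φ(|·|), ·⟫) = ⟪Φ(|·|), ·⟫` at every `v` (sphere
moments `∫ ⟪a, ω⟫ ω dσ = (4π/3) a`; both sides vanish at `v = 0`). [folklore] -/
theorem dipolePart_dipole (Φ : ℝ → EuclideanSpace ℝ (Fin 3)) (v : EuclideanSpace ℝ (Fin 3)) :
    dipolePart (fun u => ⟪Φ ‖u‖, u⟫_ℝ) v = ⟪Φ ‖v‖, v⟫_ℝ := by
  by_cases hv : v = 0
  · subst hv; simp [dipolePart]
  · unfold dipolePart
    rw [dipoleProfile_dipole Φ (norm_pos_iff.2 hv)]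

/-- The trace of a measurable `ψ`, bounded on the sphere `|u| = |v|`, is `σ`-integrable there.
[folklore] -/
theorem integrable_sphere_trace_of_bound {ψ : EuclideanSpace ℝ (Fin 3) → ℝ} (hψ : Measurable ψ)
    {v : EuclideanSpace ℝ (Fin 3)} {M : ℝ} (hM : ∀ u : EuclideanSpace ℝ (Fin 3), ‖u‖ = ‖v‖ → |ψ u| ≤ M) :
    Integrable (fun ω : Metric.sphere (0 : EuclideanSpace ℝ (Fin 3)) 1 =>
      ψ (‖v‖ • (ω : EuclideanSpace ℝ (Fin 3)))) sphereMeasure := by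
  haveI := isFiniteMeasure_sphereMeasure (E := EuclideanSpace ℝ (Fin 3))
  refine (integrable_const M).mono'
    (hψ.comp (by fun_prop : Continuous fun ω : Metric.sphere (0 : EuclideanSpace ℝ (Fin 3)) 1 =>
      ‖v‖ • (ω : EuclideanSpace ℝ (Fin 3))).measurable).aestronglyMeasurable
    (Eventually.of_forall fun ω => ?_)
  rw [Real.norm_eq_abs]
  exact hM _ (by rw [norm_smul, norm_norm, norm_eq_of_mem_sphere ω, mul_one])

/-- Integral form: `Π₁ψ(v) = (3/(4π|v|)) ∫_{S²} ψ(|v|ω) ⟪v, ω⟫ dσ(ω)` (trace integrable).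
[folklore] -/
theorem dipolePart_eq_integral_sphere {ψ : EuclideanSpace ℝ (Fin 3) → ℝ} {v : EuclideanSpace ℝ (Fin 3)}
    (h : Integrable (fun ω : Metric.sphere (0 : EuclideanSpace ℝ (Fin 3)) 1 =>
      ψ (‖v‖ • (ω : EuclideanSpace ℝ (Fin 3)))) sphereMeasure) :
    dipolePart ψ v = 3 / (4 * π * ‖v‖) * ∫ ω : Metric.sphere (0 : EuclideanSpace ℝ (Fin 3)) 1,
      ψ (‖v‖ • (ω : EuclideanSpace ℝ (Fin 3))) * ⟪v, (ω : EuclideanSpace ℝ (Fin 3))⟫_ℝ ∂sphereMeasure := by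
  unfold dipolePart dipoleProfile
  rw [real_inner_smul_left, real_inner_comm, ← integral_inner (integrable_smul_sphere h) v]
  simp_rw [real_inner_smul_right]

/-! ### The character of the vector representation of `O(3)` and the orbit form of `Π₁` -/

/-- **The character `χ(R) = tr R⁻¹ = tr R`** of the vector representation of `O(3)`, written as
the sum of the diagonal matrix coefficients of `R⁻¹` in the standard basis. [folklore] -/
def rotTrace (R : unitary (EuclideanSpace ℝ (Fin 3) →L[ℝ] EuclideanSpace ℝ (Fin 3))) : ℝ :=
  ∑ i, ⟪(EuclideanSpace.basisFun (Fin 3) ℝ) i, haarRot R ((EuclideanSpace.basisFun (Fin 3) ℝ) i)⟫_ℝ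

/-- The character is continuous. [folklore] -/
theorem continuous_rotTrace : Continuous rotTrace := by
  unfold rotTrace
  refine continuous_finsetSum _ fun i _ => ?_
  exact continuous_const.inner (continuous_haarRot_apply continuous_id continuous_const)

/-- `|χ(R)| ≤ 3`. [folklore] -/
theorem abs_rotTrace_le (R : unitary (EuclideanSpace ℝ (Fin 3) →L[ℝ] EuclideanSpace ℝ (Fin 3))) :
    |rotTrace R| ≤ 3 := by
  unfold rotTrace
  refine (Finset.abs_sum_le_sum_abs _ _).trans ?_
  have h : ∀ i ∈ Finset.univ, |⟪(EuclideanSpace.basisFun (Fin 3) ℝ) i,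
      haarRot R ((EuclideanSpace.basisFun (Fin 3) ℝ) i)⟫_ℝ| ≤ (1 : ℝ) := fun i _ => by
    refine (abs_real_inner_le_norm _ _).trans ?_
    rw [LinearIsometryEquiv.norm_map, (EuclideanSpace.basisFun (Fin 3) ℝ).orthonormal.1 i]
    norm_num
  refine (Finset.sum_le_sum h).trans ?_
  simp

/-- **The diagonal matrix coefficient `⟪R⁻¹v̂, v̂⟫` may be replaced by the character**:
`∫_{O(3)} (χ(R) - ⟪R⁻¹v, v⟫/|v|²) g(R⁻¹v) dR = 0` for every `g` and `v` (the reflection `S`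
in the line `ℝv` fixes `v`, and the substitution `R ↦ SR` — Haar is left invariant — changes
the sign of the integrand: `χ(SR) = 2⟪R⁻¹v, v⟫/|v|² - χ(R)`; no integrability needed). This
is the one-element shadow of averaging over the stabiliser `O(2)` of `v`. [folklore] -/
theorem integral_haar_rotTrace_sub_coeff_mul_eq_zero (g : EuclideanSpace ℝ (Fin 3) → ℝ)
    (v : EuclideanSpace ℝ (Fin 3)) :
    ∫ R, (rotTrace R - ⟪haarRot R v, v⟫_ℝ / ‖v‖ ^ 2) * g (haarRot R v) ∂Measure.haarMeasure ⊤ = 0 := by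
  set S : EuclideanSpace ℝ (Fin 3) ≃ₗᵢ[ℝ] EuclideanSpace ℝ (Fin 3) := (ℝ ∙ v).reflection with hSdef
  have hSv : S v = v := Submodule.reflection_mem_subspace_eq_self (Submodule.mem_span_singleton_self v)
  have hSu : ∀ u, S u = (2 * (⟪v, u⟫_ℝ / ‖v‖ ^ 2)) • v - u := fun u => by
    rw [hSdef, Submodule.reflection_singleton_apply, two_smul ℕ, ← two_smul ℝ, smul_smul]; rfl
  set s : unitary (EuclideanSpace ℝ (Fin 3) →L[ℝ] EuclideanSpace ℝ (Fin 3)) :=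
    Unitary.linearIsometryEquiv.symm S with hsdef
  have key : ∀ (R : unitary (EuclideanSpace ℝ (Fin 3) →L[ℝ] EuclideanSpace ℝ (Fin 3))) u,
      haarRot (s⁻¹ * R) u = haarRot R (S u) := by
    intro R u
    rw [haarRot_apply, haarRot_apply, mul_inv_rev, inv_inv, Submonoid.coe_mul, mul_apply_eq_comp]
    rfl
  have htr : ∀ R : unitary (EuclideanSpace ℝ (Fin 3) →L[ℝ] EuclideanSpace ℝ (Fin 3)),
      rotTrace (s⁻¹ * R) = 2 * (⟪haarRot R v, v⟫_ℝ / ‖v‖ ^ 2) - rotTrace R := by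
    intro R
    unfold rotTrace
    simp_rw [key, hSu, map_sub, map_smul, inner_sub_right, inner_smul_right]
    rw [Finset.sum_sub_distrib]
    congr 1
    have h1 : ∀ i, 2 * (⟪v, (EuclideanSpace.basisFun (Fin 3) ℝ) i⟫_ℝ / ‖v‖ ^ 2) *
        ⟪(EuclideanSpace.basisFun (Fin 3) ℝ) i, (haarRot R) v⟫_ℝ = 2 / ‖v‖ ^ 2 *
        (⟪v, (EuclideanSpace.basisFun (Fin 3) ℝ) i⟫_ℝ *
          ⟪(EuclideanSpace.basisFun (Fin 3) ℝ) i, (haarRot R) v⟫_ℝ) := fun i => by ring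
    simp_rw [h1]
    rw [← Finset.mul_sum, (EuclideanSpace.basisFun (Fin 3) ℝ).sum_inner_mul_inner, real_inner_comm]
    ring
  have hF : ∀ R : unitary (EuclideanSpace ℝ (Fin 3) →L[ℝ] EuclideanSpace ℝ (Fin 3)),
      (rotTrace (s⁻¹ * R) - ⟪haarRot (s⁻¹ * R) v, v⟫_ℝ / ‖v‖ ^ 2) * g (haarRot (s⁻¹ * R) v) =
        -((rotTrace R - ⟪haarRot R v, v⟫_ℝ / ‖v‖ ^ 2) * g (haarRot R v)) := by
    intro R
    rw [htr, key, hSv]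
    ring
  have h := (measurePreserving_mul_left (Measure.haarMeasure (⊤ : PositiveCompacts
    (unitary (EuclideanSpace ℝ (Fin 3) →L[ℝ] EuclideanSpace ℝ (Fin 3))))) s⁻¹).integral_comp
    (MeasurableEquiv.mulLeft s⁻¹).measurableEmbedding
    (fun R => (rotTrace R - ⟪haarRot R v, v⟫_ℝ / ‖v‖ ^ 2) * g (haarRot R v))
  simp only [hF, integral_neg] at h
  linarith

/-- **Orbit (character) form of the dipole projection**: for `ψ` measurable and bounded on the
sphere `|u| = |v|`, `Π₁ψ(v) = 3 ∫_{O(3)} χ(R) ψ(R⁻¹v) dR` (normalised Haar measure,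
`χ = rotTrace`). Proof: replace `χ(R)` by the matrix coefficient `⟪R⁻¹v, v⟫/|v|²`
(`integral_haar_rotTrace_sub_coeff_mul_eq_zero`), then the orbit identity
`∫ f(R⁻¹v) dR = (4π)⁻¹∫_{S²} f(|v|ω) dσ` for `f(u) = ⟪u, v⟫ψ(u)`. The weight `χ` does not
depend on `v` — this is what makes `Π₁` commute with every isotropic operator. [folklore] -/
theorem dipolePart_eq_integral_haar {ψ : EuclideanSpace ℝ (Fin 3) → ℝ} (hψ : Measurable ψ)
    (v : EuclideanSpace ℝ (Fin 3)) {M : ℝ} (hM : ∀ u : EuclideanSpace ℝ (Fin 3), ‖u‖ = ‖v‖ → |ψ u| ≤ M) :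
    dipolePart ψ v = 3 * ∫ R, rotTrace R * ψ (haarRot R v) ∂Measure.haarMeasure ⊤ := by
  have hmeas : Measurable fun R : unitary (EuclideanSpace ℝ (Fin 3) →L[ℝ] EuclideanSpace ℝ (Fin 3)) =>
      ψ (haarRot R v) := hψ.comp (continuous_haarRot_apply continuous_id continuous_const).measurable
  have hb : ∀ R : unitary (EuclideanSpace ℝ (Fin 3) →L[ℝ] EuclideanSpace ℝ (Fin 3)),
      |ψ (haarRot R v)| ≤ M := fun R => hM _ (LinearIsometryEquiv.norm_map _ _)
  have hc : ∀ R : unitary (EuclideanSpace ℝ (Fin 3) →L[ℝ] EuclideanSpace ℝ (Fin 3)),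
      |⟪haarRot R v, v⟫_ℝ / ‖v‖ ^ 2| ≤ 1 := fun R => by
    rw [abs_div, abs_of_nonneg (by positivity : (0 : ℝ) ≤ ‖v‖ ^ 2)]
    refine div_le_one_of_le₀ ((abs_real_inner_le_norm _ _).trans ?_) (by positivity)
    rw [LinearIsometryEquiv.norm_map, sq]
  have hcm : Continuous fun R : unitary (EuclideanSpace ℝ (Fin 3) →L[ℝ] EuclideanSpace ℝ (Fin 3)) =>
      ⟪haarRot R v, v⟫_ℝ / ‖v‖ ^ 2 :=
    ((continuous_haarRot_apply continuous_id continuous_const).inner continuous_const).div_const _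
  have int1 : Integrable (fun R : unitary (EuclideanSpace ℝ (Fin 3) →L[ℝ] EuclideanSpace ℝ (Fin 3)) =>
      ⟪haarRot R v, v⟫_ℝ / ‖v‖ ^ 2 * ψ (haarRot R v)) (Measure.haarMeasure ⊤) := by
    refine (integrable_const M).mono' (hcm.measurable.mul hmeas).aestronglyMeasurable
      (Eventually.of_forall fun R => ?_)
    rw [Real.norm_eq_abs, abs_mul]
    exact (mul_le_of_le_one_left (abs_nonneg _) (hc R)).trans (hb R)
  have int2 : Integrable (fun R : unitary (EuclideanSpace ℝ (Fin 3) →L[ℝ] EuclideanSpace ℝ (Fin 3)) =>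
      rotTrace R * ψ (haarRot R v)) (Measure.haarMeasure ⊤) := by
    refine (integrable_const (3 * M)).mono' (continuous_rotTrace.measurable.mul hmeas).aestronglyMeasurable
      (Eventually.of_forall fun R => ?_)
    rw [Real.norm_eq_abs, abs_mul]
    exact mul_le_mul (abs_rotTrace_le R) (hb R) (abs_nonneg _) (by norm_num)
  have hsplit : (fun R : unitary (EuclideanSpace ℝ (Fin 3) →L[ℝ] EuclideanSpace ℝ (Fin 3)) =>
      rotTrace R * ψ (haarRot R v)) = fun R =>
      (rotTrace R - ⟪haarRot R v, v⟫_ℝ / ‖v‖ ^ 2) * ψ (haarRot R v) +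
        (‖v‖ ^ 2)⁻¹ * (⟪haarRot R v, v⟫_ℝ * ψ (haarRot R v)) := by
    funext R; rw [div_eq_mul_inv]; ring
  have int3 : Integrable (fun R : unitary (EuclideanSpace ℝ (Fin 3) →L[ℝ] EuclideanSpace ℝ (Fin 3)) =>
      (rotTrace R - ⟪haarRot R v, v⟫_ℝ / ‖v‖ ^ 2) * ψ (haarRot R v)) (Measure.haarMeasure ⊤) :=
    (int2.sub int1).congr (Eventually.of_forall fun R => by simp only [Pi.sub_apply]; ring)
  have int4 : Integrable (fun R : unitary (EuclideanSpace ℝ (Fin 3) →L[ℝ] EuclideanSpace ℝ (Fin 3)) =>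
      (‖v‖ ^ 2)⁻¹ * (⟪haarRot R v, v⟫_ℝ * ψ (haarRot R v))) (Measure.haarMeasure ⊤) :=
    int1.congr (Eventually.of_forall fun R => by simp only [div_eq_mul_inv]; ring)
  -- the orbit identity for `f(u) = ⟪u, v⟫ ψ(u)`
  have horb := integral_haar_comp_eq_sphereAvg (f := fun u => ⟪u, v⟫_ℝ * ψ u)
    ((continuous_id.inner continuous_const).measurable.mul hψ) v (M := ‖v‖ * ‖v‖ * M) fun ω => by
    rw [abs_mul]
    refine mul_le_mul ((abs_real_inner_le_norm _ _).trans_eq ?_) (hM _ ?_) (abs_nonneg _) (by positivity)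
    all_goals rw [norm_smul, norm_norm, norm_eq_of_mem_sphere ω, mul_one]
  rw [hsplit, integral_add int3 int4, integral_haar_rotTrace_sub_coeff_mul_eq_zero, zero_add,
    integral_const_mul, horb, dipolePart_eq_integral_sphere (integrable_sphere_trace_of_bound hψ hM)]
  simp_rw [real_inner_smul_left, real_inner_comm _ v, mul_assoc]
  rw [integral_const_mul]
  by_cases hv : ‖v‖ = 0
  · rw [hv]; simp
  · simp_rw [mul_comm (ψ _) _]
    field_simp

/-- Gaussian-growth form of the orbit identity: `Π₁ψ(v) = 3∫_{O(3)} χ(R) ψ(R⁻¹v) dR` for `ψ`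
measurable with `|ψ| ≤ C e^{|·|²/4}`. [folklore] -/
theorem dipolePart_eq_integral_haar_of_gaussGrowth {ψ : EuclideanSpace ℝ (Fin 3) → ℝ} (hψ : Measurable ψ)
    {C : ℝ} (hC : ∀ x, |ψ x| ≤ C * Real.exp (‖x‖ ^ 2 / 4)) (v : EuclideanSpace ℝ (Fin 3)) :
    dipolePart ψ v = 3 * ∫ R, rotTrace R * ψ (haarRot R v) ∂Measure.haarMeasure ⊤ :=
  dipolePart_eq_integral_haar hψ v (M := C * Real.exp (‖v‖ ^ 2 / 4)) fun u hu => by rw [← hu]; exact hC u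

/-- `R ↦ χ(R) ψ(R⁻¹u)` is Haar-integrable for `ψ` measurable of Gaussian growth. [folklore] -/
theorem integrable_haar_rotTrace_mul {ψ : EuclideanSpace ℝ (Fin 3) → ℝ} (hψ : Measurable ψ) {C : ℝ}
    (hC : ∀ x, |ψ x| ≤ C * Real.exp (‖x‖ ^ 2 / 4)) (u : EuclideanSpace ℝ (Fin 3)) :
    Integrable (fun R : unitary (EuclideanSpace ℝ (Fin 3) →L[ℝ] EuclideanSpace ℝ (Fin 3)) =>
      rotTrace R * ψ (haarRot R u)) (Measure.haarMeasure ⊤) :=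
  (integrable_haar_comp hψ hC u).bdd_mul continuous_rotTrace.aestronglyMeasurable
    (ae_of_all _ fun R => by rw [Real.norm_eq_abs]; exact abs_rotTrace_le R)

/-! ### Z2: the dipole projection commutes with `L` -/

/-- **The dipole projection commutes with the linearised hard-sphere operator**: for `ψ`
measurable of Gaussian growth `|ψ| ≤ C e^{|·|²/4}` and every `v`,
`L(Π₁ψ)(v) = Π₁(Lψ)(v) = ⟪Φ_{Lψ}(|v|), v⟫`. Proof: `Π₁ψ = 3∫_{O(3)} χ(R) (ψ ∘ R⁻¹) dR` with the
`v`-independent weight `χ(R) = tr R` (`dipolePart_eq_integral_haar`), Fubini in `dσ dM dR` (the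
rotated four-term kernel integrand is dominated by `36 C (1+|v|)e^{|v|²/4}(1+|v_*|)e^{|v_*|²/4}`),
isotropy `L(ψ ∘ R⁻¹)(v) = (Lψ)(R⁻¹v)` (CIP 1994 §7.3 p. 209), and the orbit identity again for
`Lψ` (measurable, bounded on spheres). [folklore] -/
theorem hardSphereLinearizedOp_dipolePart {ψ : EuclideanSpace ℝ (Fin 3) → ℝ} (hψ : Measurable ψ) {C : ℝ}
    (hC : ∀ x, |ψ x| ≤ C * Real.exp (‖x‖ ^ 2 / 4)) (v : EuclideanSpace ℝ (Fin 3)) :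
    hardSphereLinearizedOp (dipolePart ψ) v = dipolePart (hardSphereLinearizedOp ψ) v := by
  haveI := isFiniteMeasure_sphereMeasure (E := EuclideanSpace ℝ (Fin 3))
  have hC0 : 0 ≤ C := le_trans (abs_nonneg _) ((hC 0).trans (by simp))
  set F : unitary (EuclideanSpace ℝ (Fin 3) →L[ℝ] EuclideanSpace ℝ (Fin 3)) → EuclideanSpace ℝ (Fin 3) →
      Metric.sphere (0 : EuclideanSpace ℝ (Fin 3)) 1 → ℝ := fun R w ω => (3 * rotTrace R) *
    (hardSphereKernel (v, w) ω * (ψ (haarRot R (collide ω (v, w)).1) + ψ (haarRot R (collide ω (v, w)).2) -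
      ψ (haarRot R v) - ψ (haarRot R w))) with hF
  have hFb : ∀ R w ω, |F R w ω| ≤
      9 * (4 * C * ((1 + ‖v‖) * Real.exp (‖v‖ ^ 2 / 4))) * ((1 + ‖w‖) * Real.exp (‖w‖ ^ 2 / 4)) := by
    intro R w ω
    rw [hF, abs_mul, mul_assoc (9 : ℝ)]
    refine mul_le_mul ?_ (abs_kernelIntegrand_four_le hC0 hC (haarRot R) v w ω) (abs_nonneg _) (by norm_num)
    rw [abs_mul, abs_of_pos (by norm_num : (0 : ℝ) < 3)]
    linarith [abs_rotTrace_le R]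
  have hI := integrable_haar_rotTrace_mul hψ hC
  have h1 : hardSphereLinearizedOp (dipolePart ψ) v =
      ∫ w, ∫ ω, ∫ R, F R w ω ∂Measure.haarMeasure ⊤ ∂sphereMeasure ∂stdGaussian (EuclideanSpace ℝ (Fin 3)) := by
    unfold hardSphereLinearizedOp linearizedCollisionOp
    congr 1 with w
    congr 1 with ω
    have hr := dipolePart_eq_integral_haar_of_gaussGrowth hψ hC
    rw [hr, hr, hr, hr]
    have e : ∀ R, F R w ω = hardSphereKernel (v, w) ω *
        (3 * (rotTrace R * ψ (haarRot R (collide ω (v, w)).1)) +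
          3 * (rotTrace R * ψ (haarRot R (collide ω (v, w)).2)) - 3 * (rotTrace R * ψ (haarRot R v)) -
          3 * (rotTrace R * ψ (haarRot R w))) := fun R => by rw [hF]; ring
    simp_rw [e]
    rw [integral_const_mul, integral_sub ?_ ((hI w).const_mul 3), integral_sub ?_ ((hI v).const_mul 3),
      integral_add ((hI _).const_mul 3) ((hI _).const_mul 3), integral_const_mul, integral_const_mul,
      integral_const_mul, integral_const_mul]
    · exact ((hI _).const_mul 3).add ((hI _).const_mul 3)
    · exact (((hI _).const_mul 3).add ((hI _).const_mul 3)).sub ((hI _).const_mul 3)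
  have hm : ∀ {X : Type} [TopologicalSpace X] [MeasurableSpace X] [OpensMeasurableSpace X]
      {R : X → unitary (EuclideanSpace ℝ (Fin 3) →L[ℝ] EuclideanSpace ℝ (Fin 3))}
      {w : X → EuclideanSpace ℝ (Fin 3)} {ω : X → Metric.sphere (0 : EuclideanSpace ℝ (Fin 3)) 1},
      Continuous R → Continuous w → Continuous ω → Measurable fun x => F (R x) (w x) (ω x) := by
    intro X _ _ _ R w ω hR hw hω
    exact ((continuous_rotTrace.comp hR).measurable.const_mul 3).mul
      (measurable_kernelIntegrand_haarRot hψ v hR hw hω)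
  have h2 : ∀ w, ∫ ω, ∫ R, F R w ω ∂Measure.haarMeasure ⊤ ∂sphereMeasure =
      ∫ R, ∫ ω, F R w ω ∂sphereMeasure ∂Measure.haarMeasure ⊤ := by
    intro w
    refine integral_integral_swap ((integrable_const
      ((9 * (4 * C * ((1 + ‖v‖) * Real.exp (‖v‖ ^ 2 / 4)))) * ((1 + ‖w‖) * Real.exp (‖w‖ ^ 2 / 4)))).mono'
      ?_ (Eventually.of_forall fun p => ?_))
    · exact (hm continuous_snd continuous_const continuous_fst).aestronglyMeasurable
    · rw [Real.norm_eq_abs]; exact hFb p.2 w p.1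
  have h3 : ∫ w, ∫ R, ∫ ω, F R w ω ∂sphereMeasure ∂Measure.haarMeasure ⊤ ∂stdGaussian (EuclideanSpace ℝ (Fin 3)) =
      ∫ R, ∫ w, ∫ ω, F R w ω ∂sphereMeasure ∂stdGaussian (EuclideanSpace ℝ (Fin 3)) ∂Measure.haarMeasure ⊤ := by
    refine integral_integral_swap ?_
    refine ((((integrable_one_add_norm_mul_exp_sq_div_four_stdGaussian
      (E := EuclideanSpace ℝ (Fin 3))).const_mul (9 * (4 * C * ((1 + ‖v‖) * Real.exp (‖v‖ ^ 2 / 4))))).mul_const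
      ((sphereMeasure : Measure (Metric.sphere (0 : EuclideanSpace ℝ (Fin 3)) 1)).real univ)).comp_fst
      (Measure.haarMeasure ⊤)).mono'
      ((hm (continuous_snd.comp continuous_fst) (continuous_fst.comp continuous_fst)
        continuous_snd).stronglyMeasurable.integral_prod_right'
        (ν := (sphereMeasure : Measure (Metric.sphere (0 : EuclideanSpace ℝ (Fin 3)) 1)))).aestronglyMeasurable
      (Eventually.of_forall fun q => ?_)
    exact norm_integral_le_of_norm_le_const (Eventually.of_forall fun ω => by
      rw [Real.norm_eq_abs]; exact hFb q.2 q.1 ω)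
  have h4 : ∀ R : unitary (EuclideanSpace ℝ (Fin 3) →L[ℝ] EuclideanSpace ℝ (Fin 3)),
      ∫ w, ∫ ω, F R w ω ∂sphereMeasure ∂stdGaussian (EuclideanSpace ℝ (Fin 3)) =
        3 * (rotTrace R * hardSphereLinearizedOp ψ (haarRot R v)) := by
    intro R
    have e : ∀ w, ∫ ω, F R w ω ∂sphereMeasure =
        (3 * rotTrace R) * ∫ ω, hardSphereKernel (v, w) ω * (ψ (haarRot R (collide ω (v, w)).1) +
          ψ (haarRot R (collide ω (v, w)).2) - ψ (haarRot R v) - ψ (haarRot R w)) ∂sphereMeasure :=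
      fun w => by rw [hF]; exact integral_const_mul _ _
    simp_rw [e]
    rw [integral_const_mul, ← hardSphereLinearizedOp_comp_linearIsometryEquiv_apply (haarRot R) ψ v,
      mul_assoc]
    rfl
  obtain ⟨M, hM⟩ := exists_abs_hardSphereLinearizedOp_le_on_sphere hψ hC ‖v‖
  rw [h1]; simp_rw [h2]; rw [h3]; simp_rw [h4]
  rw [integral_const_mul,
    dipolePart_eq_integral_haar (measurable_hardSphereLinearizedOp_of_gaussGrowth hψ hC) v hM]

/-- **Registered helper `t12_hardSphereLinearizedOp_dipolePart_comm`** (Z2 of the corrector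
plan): the dipole (`ℓ = 1`) projection `Π₁ψ(u) = ⟪Φ_ψ(|u|), u⟫`,
`Φ_ψ(r) = (3/(4πr))∫_{S²} ψ(rω) ω dσ(ω)` (`dipoleProfile`), commutes with the linearised
hard-sphere operator on measurable functions of Gaussian growth: `L(Π₁ψ)(v) = Π₁(Lψ)(v)` for
every `v` — so that the `ℓ = 1` sector equation of `Lψ = g` (whose profile carries the radial
log-modulus of `t12_logLinearPreimage_and_dipoleModulus`) decouples exactly. (Stated with
`dipolePart` unfolded.) [folklore] -/
theorem t12_hardSphereLinearizedOp_dipolePart_comm : ∀ (ψ : EuclideanSpace ℝ (Fin 3) → ℝ) (C : ℝ), Measurable ψ → (∀ x, |ψ x| ≤ C * Real.exp (‖x‖ ^ 2 / 4)) → ∀ v : EuclideanSpace ℝ (Fin 3), Literature.Analysis.UnboundedOperators.hardSphereLinearizedOp (fun u : EuclideanSpace ℝ (Fin 3) => inner ℝ (Summit.AtomisticToContinuum.HydrodynamicLimit.Theorems.ClampedCorrectorBirth.dipoleProfile ψ ‖u‖) u) v = inner ℝ (Summit.AtomisticToContinuum.HydrodynamicLimit.Theorems.ClampedCorrectorBirth.dipoleProfile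 (Literature.Analysis.UnboundedOperators.hardSphereLinearizedOp ψ) ‖v‖) v :=
  fun _ _ hψ hC v => hardSphereLinearizedOp_dipolePart hψ hC v

/-- **Registered helper `t12_hardSphereLinearizedOp_dipole`** (Z2', route (ii) of the plan:
dipole in, dipole out): for a dipole field `ψ(u) = ⟪Φ(|u|), u⟫`, measurable of Gaussian growth,
`Lψ` is again a dipole field and its profile is the dipole profile of `Lψ`:
`(Lψ)(v) = ⟪Φ_{Lψ}(|v|), v⟫` for every `v` (`Π₁ψ = ψ` pointwise, then Z2). With the isotropy
of `L` this is the rotation-covariant `ℓ = 1` sector equation of the corrector plan. [folklore] -/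
theorem t12_hardSphereLinearizedOp_dipole : ∀ (Φ : ℝ → EuclideanSpace ℝ (Fin 3)) (C : ℝ), Measurable (fun u : EuclideanSpace ℝ (Fin 3) => inner ℝ (Φ ‖u‖) u) → (∀ u : EuclideanSpace ℝ (Fin 3), |inner ℝ (Φ ‖u‖) u| ≤ C * Real.exp (‖u‖ ^ 2 / 4)) → ∀ v : EuclideanSpace ℝ (Fin 3), Literature.Analysis.UnboundedOperators.hardSphereLinearizedOp (fun u : EuclideanSpace ℝ (Fin 3) => inner ℝ (Φ ‖u‖) u) v = inner ℝ (Summit.AtomisticToContinuum.HydrodynamicLimit.Theorems.ClampedCorrectorBirth.dipoleProfile (Literature.Analysis.UnboundedOperators.hardSphereLinearizedOp (fun u : EuclideanSpace ℝ (Fin 3) => inner ℝ (Φ ‖u‖) u)) ‖v‖) v := by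
  intro Φ C hψ hC v
  have h : dipolePart (fun u : EuclideanSpace ℝ (Fin 3) => ⟪Φ ‖u‖, u⟫_ℝ) =
      fun u : EuclideanSpace ℝ (Fin 3) => ⟪Φ ‖u‖, u⟫_ℝ := funext (dipolePart_dipole Φ)
  have h2 := hardSphereLinearizedOp_dipolePart hψ hC v
  rwa [h] at h2

/-- `dipolePart` form of Z2': `Π₁ψ = ψ` pointwise implies `Π₁(Lψ) = Lψ` pointwise (Gaussian
growth class). [folklore] -/
theorem dipolePart_hardSphereLinearizedOp_of_dipolePart_eq {ψ : EuclideanSpace ℝ (Fin 3) → ℝ}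
    (hψ : Measurable ψ) {C : ℝ} (hC : ∀ x, |ψ x| ≤ C * Real.exp (‖x‖ ^ 2 / 4))
    (h : ∀ u, dipolePart ψ u = ψ u) (v : EuclideanSpace ℝ (Fin 3)) :
    dipolePart (hardSphereLinearizedOp ψ) v = hardSphereLinearizedOp ψ v := by
  rw [← hardSphereLinearizedOp_dipolePart hψ hC v, show dipolePart ψ = ψ from funext h]

end Summit.AtomisticToContinuum.HydrodynamicLimit.Theorems.ClampedCorrectorBirth
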